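import Summits.CriticalPhenomena.SAWScalingLimit.Theorems.SAWDevelopingMapObservableToSLEHullApproxCut
import Literature.Probability.RandomPlanarGeometry.HullSubdomainPullback
import Literature.Probability.RandomPlanarGeometry.ConformalMapCaratheodoryProofs
import HarnessLib

/-!
# Crux `SAWDevelopingMap.ObservableToSLE` (stmt-CriticalPhenomena-10472), line
`floor-ratio-restriction-bootstrap`: swallowing one more smooth hull (helper for STUB 4b)

Landing target:
`Summits/CriticalPhenomena/SAWScalingLimit/Theorems/SAWDevelopingMapObservableToSLEHullApproxStep.lean`
(`--supports stmt-CriticalPhenomena-10472`).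

The inductive step of the "hull approximation from outside" (STUB 4b, `stub_hullApproxDomain`):
let `φ : (ℍ; 0, ∞) → (D; a, b)` be a chordal uniformizing map of a Dobrushin domain, `D₁` a hull
subdomain of `D` with `D₁ = φ(ℍ ∖ A₁)`, and `J ∌ 0` a smooth hull (`IsArcHull`) disjoint from
`A₁`. Then `φ(ℍ ∖ (A₁ ∪ J))` is again the carrier of a hull subdomain `D₂` of `D`. Proof: the
boundary arc `γ` of `J` (`IsArcHull.sides`), pushed forward by the Carathéodory extension of
`φ` (Pommerenke 1992, Thm. 2.6, `JordanDomain.exists_continuousOn_extension_holds`), is a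
cross-cut `L` of the Jordan domain `D₁`; `D₁ ∖ L = φ(ℍ ∖ (A₁ ∪ J)) ⊔ φ(int J ∩ ℍ)` is a
decomposition into two nonempty open sets, so by `stub_hullApproxDomain_cut` (Newman's cross-cut
theorem) the first is a Dobrushin domain with marked points `a`, `b`; the removed part
`D ∖ D₂ ⊆ (D ∖ D₁) ∪ φ(J)` stays away from `a` and `b` because `0 ∉ J` and `J` is bounded.

* `pushArc_isSimpleArc` — the pushed-forward boundary arc is a simple arc;
* `stub_hullApproxDomain_step` — **the swallowing step** (registered sub-goal of STUB 4b).
-/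

noncomputable section

open Set Filter Topology Metric Complex Function
open Literature.Probability.RandomPlanarGeometry
open Literature.Topology.PlaneTopology
open UpperHalfPlane (upperHalfPlaneSet isOpen_upperHalfPlaneSet)
open scoped unitInterval

namespace Summit.CriticalPhenomena.SAWScalingLimit.Theorems.ObservableToSLE.FloorRatio

/-- Interior parameters of the boundary arc of a smooth hull are mapped into `ℍ`. [folklore] -/
theorem im_pos_of_arc {x₀ x₁ : ℝ} {P : Path (x₀ : ℂ) (x₁ : ℂ)} (hPi : Injective P)
    (him : ∀ s : I, 0 ≤ (P s).im) (hreal : ∀ s : I, (P s).im = 0 → P s = x₀ ∨ P s = x₁)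
    {s : I} (h0 : 0 < (s : ℝ)) (h1 : (s : ℝ) < 1) : 0 < (P s).im := by
  rcases (him s).lt_or_eq with h | h
  · exact h
  · exfalso
    rcases hreal s h.symm with h' | h'
    · have : s = 0 := hPi (by rw [h', P.source])
      rw [this] at h0
      norm_num at h0
    · have : s = 1 := hPi (by rw [h', P.target])
      rw [this] at h1
      norm_num at h1

/-- **The pushed-forward arc is a simple arc**: for `Ψ` continuous and injective on the closed
unit disc and an injective path `P` in the closed upper half-plane, `Ψ ∘ C ∘ P` (`C` the Cayley
transform) is a simple arc from `Ψ (C x₀)` to `Ψ (C x₁)` with image `Ψ (C (range P))`. [folklore] -/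
theorem pushArc_isSimpleArc {Ψ : ℂ → ℂ} (hΨc : ContinuousOn Ψ (closedBall 0 1))
    (hΨinj : InjOn Ψ (closedBall 0 1)) {x₀ x₁ : ℝ} {P : Path (x₀ : ℂ) (x₁ : ℂ)}
    (hPi : Injective P) (him : ∀ s : I, 0 ≤ (P s).im) :
    IsSimpleArc ((fun z ↦ Ψ (cayleyFun z)) '' range P) (Ψ (cayleyFun x₀)) (Ψ (cayleyFun x₁)) := by
  have hcmem : ∀ {z : ℂ}, 0 ≤ z.im → cayleyFun z ∈ closedBall (0 : ℂ) 1 := fun hz ↦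
    mem_closedBall_zero_iff.2 (norm_cayleyFun_le_one hz)
  have hext : ∀ u : ℝ, P.extend u ∈ range P := fun u ↦ by
    rw [← P.extend_range]; exact mem_range_self u
  have himext : ∀ u : ℝ, 0 ≤ (P.extend u).im := fun u ↦ by
    obtain ⟨s, hs⟩ := hext u
    rw [← hs]; exact him s
  set γ : ℝ → ℂ := fun u ↦ Ψ (cayleyFun (P.extend u)) with hγ
  have hγc : Continuous γ := by
    have h1 : Continuous fun u ↦ cayleyFun (P.extend u) :=
      continuousOn_cayleyFun.comp_continuous P.extend.continuous fun u ↦ add_I_ne_zero (himext u)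
    exact hΨc.comp_continuous h1 fun u ↦ hcmem (himext u)
  refine ⟨γ, hγc.continuousOn, ?_, ?_, ?_, ?_⟩
  · intro u hu v hv huv
    simp only [hγ, Path.extend_apply P hu, Path.extend_apply P hv] at huv
    have h1 := hΨinj (hcmem (him _)) (hcmem (him _)) huv
    have h2 := cayleyFun_injOn (him _) (him _) h1
    have h3 := hPi h2
    exact congrArg Subtype.val h3
  · rw [hγ, show (fun u ↦ Ψ (cayleyFun (P.extend u))) = (fun z ↦ Ψ (cayleyFun z)) ∘ P.extend from rfl,
      image_comp, P.image_extend_of_subset Subset.rfl]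
  · simp [hγ, P.extend_zero]
  · simp [hγ, P.extend_one]

/-- **The swallowing step.** For a chordal uniformizing map `φ` of `(D; a, b)`, a hull subdomain
`D₁ = φ(ℍ ∖ A₁)` and a smooth hull `J ∌ 0` disjoint from `A₁`, `φ(ℍ ∖ (A₁ ∪ J))` is the carrier
of a hull subdomain of `D` (Carathéodory extension of `φ`, Pommerenke (1992) Thm. 2.6, and
Newman's cross-cut theorem via `stub_hullApproxDomain_cut`). Registered sub-goal
`stub_hullApproxDomain_step` of STUB 4b (`stub_hullApproxDomain`). [cite: PommerenkeBBCM1992, Thm. 2.6] -/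
theorem stub_hullApproxDomain_step :
    ∀ (D D₁ : DobrushinDomain) (φ : ConformalEquiv upperHalfPlaneSet D.carrier) (A₁ J : Set ℂ),
      D.IsChordalUniformizing φ → D.IsHullSubdomain D₁ →
      D₁.carrier = φ '' (upperHalfPlaneSet \ A₁) → IsArcHull J → (0 : ℂ) ∉ J → Disjoint J A₁ →
      ∃ D₂ : DobrushinDomain, D.IsHullSubdomain D₂ ∧
        D₂.carrier = φ '' (upperHalfPlaneSet \ (A₁ ∪ J)) := by
  intro D D₁ φ A₁ J hφ hD₁ hcar hJ h0J hJA
  classical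
  obtain ⟨x₀, x₁, P, hlt, hPi, him, hreal, hPJ, hfr, hnotcl, -⟩ := hJ.sides JordanCurveTheorem_holds
  have hJc : IsClosed J := hJ.1.isClosed
  -- Carathéodory
  obtain ⟨Ψ, hΨc, hΨeq, hbij, hsph⟩ :=
    JordanDomain.exists_continuousOn_extension_holds D.toJordanDomain (cayley.symm.trans φ)
  have hΨinj : InjOn Ψ (closedBall 0 1) := hbij.injOn
  have hφΨ : EqOn φ (Ψ ∘ cayleyFun) upperHalfPlaneSet := JordanDomain.eqOn_comp_cayleyFun φ hΨeq
  have ha : Ψ (-1) = D.pt 0 := by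
    rw [← cayleyFun_zero]
    have h := JordanDomain.extension_cayleyFun_eq φ hΨc hΨeq (x := 0) (p := D.pt 0)
      (by simpa using hφ.1)
    simpa using h
  have hb : Ψ 1 = D.pt 1 := by
    haveI := neBot_cocompact_inf_principal_upperHalfPlaneSet
    exact tendsto_nhds_unique (JordanDomain.tendsto_cocompact_of_extension φ hΨc hΨeq) hφ.2
  have hcmem : ∀ {z : ℂ}, 0 ≤ z.im → cayleyFun z ∈ closedBall (0 : ℂ) 1 := fun hz ↦
    mem_closedBall_zero_iff.2 (norm_cayleyFun_le_one hz)
  -- the extension `Φ = Ψ ∘ C` of `φ` to the closed half-plane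
  set Φ : ℂ → ℂ := fun z ↦ Ψ (cayleyFun z) with hΦ
  have hΦφ : ∀ {z : ℂ}, z ∈ upperHalfPlaneSet → Φ z = φ z := fun hz ↦ (hφΨ hz).symm
  have hΦinj : ∀ {z w : ℂ}, 0 ≤ z.im → 0 ≤ w.im → Φ z = Φ w → z = w := fun hz hw h ↦
    cayleyFun_injOn hz hw (hΨinj (hcmem hz) (hcmem hw) h)
  have hΦfr : ∀ x : ℝ, Φ x ∈ frontier D.carrier := fun x ↦
    hsph.mapsTo (mem_sphere_zero_iff_norm.2 (norm_cayleyFun_ofReal x))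
  have hΦnot : ∀ x : ℝ, Φ x ∉ D.carrier := fun x h ↦
    Set.disjoint_left.1 D.disjoint_carrier_frontier h (hΦfr x)
  -- the compact set `T = Φ(J)` misses `a` and `b`
  set T : Set ℂ := Φ '' J with hT
  have hJim : ∀ z ∈ J, 0 ≤ z.im := fun z hz ↦
    mem_closure_upperHalfPlaneSet_iff.1 (hJ.1.subset_closure hz)
  have hTc : IsClosed T := by
    have h1 : T = Ψ '' (cayleyFun '' J) := by rw [hT, image_image]
    have h2 : IsCompact (cayleyFun '' J) := hJ.1.isCompact.image_of_continuousOn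
      (continuousOn_cayleyFun.mono fun z hz ↦ add_I_ne_zero (hJim z hz))
    have h3 : cayleyFun '' J ⊆ closedBall (0 : ℂ) 1 := by
      rintro _ ⟨z, hz, rfl⟩; exact hcmem (hJim z hz)
    rw [h1]
    exact (h2.image_of_continuousOn (hΨc.mono h3)).isClosed
  have haT : D.pt 0 ∉ T := by
    rintro ⟨z, hzJ, hz⟩
    have h0 : Φ z = Φ 0 := by rw [hz, hΦ]; simp only [cayleyFun_zero]; exact ha.symm
    exact h0J ((hΦinj (hJim z hzJ) (by simp) h0) ▸ hzJ)
  have hbT : D.pt 1 ∉ T := by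
    rintro ⟨z, hzJ, hz⟩
    rw [← hb] at hz
    have h1 := hΨinj (hcmem (hJim z hzJ)) (mem_closedBall_zero_iff.2 (by simp)) hz
    exact cayleyFun_ne_one _ h1
  -- the cross-cut `L = Φ(γ)`
  set L : Set ℂ := Φ '' range P with hL
  have hLarc : IsSimpleArc L (Φ x₀) (Φ x₁) := pushArc_isSimpleArc hΨc hΨinj hPi him
  have hLT : L ⊆ T := image_mono hPJ
  have hab : Φ x₀ ≠ Φ x₁ := fun h ↦ by
    have := hΦinj (by simp) (by simp) h
    have : x₀ = x₁ := by exact_mod_cast this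
    exact hlt.ne this
  -- interior points of the arc lie in `D₁`
  have hD₁sub : D₁.carrier ⊆ D.carrier := hD₁.carrier_subset
  have hPmem : ∀ s : I, 0 < (s : ℝ) → (s : ℝ) < 1 → Φ (P s) ∈ D₁.carrier := by
    intro s h0 h1
    have hsH : P s ∈ upperHalfPlaneSet := im_pos_of_arc hPi him hreal h0 h1
    rw [hcar, hΦφ hsH]
    exact ⟨P s, ⟨hsH, fun h ↦ Set.disjoint_left.1 hJA (hPJ ⟨s, rfl⟩) h⟩, rfl⟩
  have hPfr : ∀ s : I, 0 < (P s).im → P s ∈ frontier J := by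
    intro s hs
    have h0 : 0 < (s : ℝ) := by
      rcases s.2.1.lt_or_eq with h | h
      · exact h
      · exfalso
        have : s = 0 := Subtype.ext h.symm
        rw [this, P.source] at hs
        simp at hs
    have h1 : (s : ℝ) < 1 := by
      rcases s.2.2.lt_or_eq with h | h
      · exact h
      · exfalso
        have : s = 1 := Subtype.ext h
        rw [this, P.target] at hs
        simp at hs
    have : P s ∈ upperHalfPlaneSet ∩ frontier J := by rw [hfr]; exact ⟨s, ⟨h0, h1⟩, rfl⟩
    exact this.2
  -- the endpoints are frontier points of `D₁`
  have hγc : Continuous fun u : ℝ ↦ Φ (P.extend u) := by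
    obtain ⟨γ', hγ'c, -, -, -, -⟩ := hLarc
    have hext : ∀ u : ℝ, P.extend u ∈ range P := fun u ↦ by
      rw [← P.extend_range]; exact mem_range_self u
    have himext : ∀ u : ℝ, 0 ≤ (P.extend u).im := fun u ↦ by
      obtain ⟨s, hs⟩ := hext u
      rw [← hs]; exact him s
    have h1 : Continuous fun u ↦ cayleyFun (P.extend u) :=
      continuousOn_cayleyFun.comp_continuous P.extend.continuous fun u ↦ add_I_ne_zero (himext u)
    exact hΨc.comp_continuous h1 fun u ↦ hcmem (himext u)
  have hIoomem : ∀ u ∈ Ioo (0 : ℝ) 1, Φ (P.extend u) ∈ D₁.carrier := fun u hu ↦ by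
    rw [Path.extend_apply P ⟨hu.1.le, hu.2.le⟩]
    exact hPmem ⟨u, hu.1.le, hu.2.le⟩ hu.1 hu.2
  have hfrD₁ : ∀ {a : ℂ}, a ∈ closure D₁.carrier → a ∉ D.carrier → a ∈ frontier D₁.carrier :=
    fun ha haD ↦ ⟨ha, by rw [D₁.isOpen.interior_eq]; exact fun h ↦ haD (hD₁sub h)⟩
  have hx₀fr : Φ x₀ ∈ frontier D₁.carrier := by
    refine hfrD₁ ?_ (hΦnot x₀)
    have ht : Tendsto (fun u : ℝ ↦ Φ (P.extend u)) (𝓝[>] 0) (𝓝 (Φ x₀)) := by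
      have := (hγc.tendsto 0).mono_left (nhdsWithin_le_nhds (s := Ioi (0 : ℝ)))
      simpa [P.extend_zero] using this
    exact mem_closure_of_tendsto ht
      (by filter_upwards [Ioo_mem_nhdsGT (zero_lt_one' ℝ)] with u hu using hIoomem u hu)
  have hx₁fr : Φ x₁ ∈ frontier D₁.carrier := by
    refine hfrD₁ ?_ (hΦnot x₁)
    have ht : Tendsto (fun u : ℝ ↦ Φ (P.extend u)) (𝓝[<] 1) (𝓝 (Φ x₁)) := by
      have := (hγc.tendsto 1).mono_left (nhdsWithin_le_nhds (s := Iio (1 : ℝ)))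
      simpa [P.extend_one] using this
    exact mem_closure_of_tendsto ht
      (by filter_upwards [Ioo_mem_nhdsLT (zero_lt_one' ℝ)] with u hu using hIoomem u hu)
  -- `L` minus its endpoints lies in `D₁`
  have hLD₁ : L \ {Φ x₀, Φ x₁} ⊆ D₁.carrier := by
    rintro _ ⟨⟨_, ⟨s, rfl⟩, rfl⟩, hne⟩
    simp only [mem_insert_iff, mem_singleton_iff, not_or] at hne
    have h0 : 0 < (s : ℝ) := by
      rcases s.2.1.lt_or_eq with h | h
      · exact h
      · exfalso
        have : s = 0 := Subtype.ext h.symm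
        exact hne.1 (by rw [this, P.source])
    have h1 : (s : ℝ) < 1 := by
      rcases s.2.2.lt_or_eq with h | h
      · exact h
      · exfalso
        have : s = 1 := Subtype.ext h
        exact hne.2 (by rw [this, P.target])
    exact hPmem s h0 h1
  -- boundary parameters of the endpoints
  obtain ⟨σ₀, hσ₀⟩ : Φ x₀ ∈ range D₁.boundary := by rw [D₁.range_boundary]; exact hx₀fr
  obtain ⟨σ₁, hσ₁⟩ : Φ x₁ ∈ range D₁.boundary := by rw [D₁.range_boundary]; exact hx₁fr
  set s : ℝ := σ₀ with hs
  set t : ℝ := σ₀ + Int.fract (σ₁ - σ₀) with ht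
  have hbs : D₁.boundary s = Φ x₀ := hσ₀
  have hbt : D₁.boundary t = Φ x₁ := by
    rw [ht, Int.fract, show σ₀ + (σ₁ - σ₀ - (⌊σ₁ - σ₀⌋ : ℝ)) = σ₁ - (⌊σ₁ - σ₀⌋ : ℝ) * 1 by ring]
    rw [D₁.periodic_boundary.sub_int_mul_eq ⌊σ₁ - σ₀⌋, hσ₁]
  have hfract : 0 < Int.fract (σ₁ - σ₀) := by
    rcases (Int.fract_nonneg (σ₁ - σ₀)).lt_or_eq with h | h
    · exact h
    · exfalso
      apply hab
      rw [← hbs, ← hbt, ht, ← h, add_zero]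
  have hst : s < t := by rw [ht]; linarith
  have hts : t < s + 1 := by rw [ht, hs]; linarith [Int.fract_lt_one (σ₁ - σ₀)]
  have hcross : D₁.IsCrosscut L (D₁.boundary s) (D₁.boundary t) := by
    rw [hbs, hbt]
    exact ⟨hLarc, hx₀fr, hx₁fr, hab, hLD₁⟩
  -- the decomposition `D₁ ∖ L = φ(X) ⊔ φ(Y)`
  set X : Set ℂ := upperHalfPlaneSet \ (A₁ ∪ J) with hX
  set Y : Set ℂ := interior J ∩ upperHalfPlaneSet with hY
  have hXo : IsOpen (φ '' X) := by
    have h1 : φ '' X = D₁.carrier ∩ φ '' (upperHalfPlaneSet \ J) := by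
      apply Subset.antisymm
      · rintro _ ⟨z, hz, rfl⟩
        have hzA : z ∉ A₁ := fun h ↦ hz.2 (Or.inl h)
        have hzJ : z ∉ J := fun h ↦ hz.2 (Or.inr h)
        exact ⟨by rw [hcar]; exact ⟨z, ⟨hz.1, hzA⟩, rfl⟩, ⟨z, ⟨hz.1, hzJ⟩, rfl⟩⟩
      · rintro w ⟨hw₁, ⟨z, hz, rfl⟩⟩
        rw [hcar] at hw₁
        obtain ⟨z', hz', hzz'⟩ := hw₁
        have he : z' = z := φ.injOn hz'.1 hz.1 hzz'
        rw [he] at hz'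
        exact ⟨z, ⟨hz.1, fun h ↦ h.elim hz'.2 hz.2⟩, rfl⟩
    rw [h1]
    exact D₁.isOpen.inter (φ.isOpen_image D.isOpen (isOpen_upperHalfPlaneSet.sdiff hJc) sdiff_subset)
  have hYo : IsOpen (φ '' Y) :=
    φ.isOpen_image D.isOpen (isOpen_interior.inter isOpen_upperHalfPlaneSet) inter_subset_right
  have hXY : Disjoint (φ '' X) (φ '' Y) := by
    rw [Set.disjoint_left]
    rintro _ ⟨z, hz, rfl⟩ ⟨w, hw, hzw⟩
    have : w = z := φ.injOn hw.2 hz.1 hzw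
    rw [this] at hw
    exact hz.2 (Or.inr (interior_subset hw.1))
  have hYne : (φ '' Y).Nonempty := by
    set xm : ℝ := (x₀ + x₁) / 2 with hxm
    have h1 := hnotcl xm (by rw [hxm]; linarith) (by rw [hxm]; linarith)
    rw [mem_closure_iff_nhds] at h1
    push Not at h1
    obtain ⟨U, hU, hUJ⟩ := h1
    obtain ⟨δ, hδ, hball⟩ := Metric.mem_nhds_iff.1 hU
    set w : ℂ := (xm : ℂ) + ((δ / 2 : ℝ) : ℂ) * Complex.I with hw
    have hwim : w.im = δ / 2 := by simp [hw]
    have hwH : w ∈ upperHalfPlaneSet := by show 0 < w.im; rw [hwim]; positivity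
    have hwball : ball (xm : ℂ) δ ∩ upperHalfPlaneSet ⊆ J := by
      intro v hv
      by_contra hvJ
      have : v ∈ U ∩ (upperHalfPlaneSet \ J) := ⟨hball hv.1, hv.2, hvJ⟩
      rw [hUJ] at this
      exact this
    have hwmem : w ∈ ball (xm : ℂ) δ := by
      rw [mem_ball, dist_eq_norm, show w - (xm : ℂ) = ((δ / 2 : ℝ) : ℂ) * Complex.I by
        rw [hw]; ring, norm_mul, norm_real, norm_I, mul_one, Real.norm_of_nonneg (by positivity)]
      linarith
    have hwint : w ∈ interior J :=
      interior_mono hwball (by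
        rw [(isOpen_ball.inter isOpen_upperHalfPlaneSet).interior_eq]; exact ⟨hwmem, hwH⟩)
    exact ⟨φ w, w, ⟨hwint, hwH⟩, rfl⟩
  have hunion : φ '' X ∪ φ '' Y = D₁.carrier \ L := by
    apply Subset.antisymm
    · rintro w (⟨z, hz, rfl⟩ | ⟨z, hz, rfl⟩)
      · refine ⟨by rw [hcar]; exact ⟨z, ⟨hz.1, fun h ↦ hz.2 (Or.inl h)⟩, rfl⟩, ?_⟩
        rintro ⟨v, ⟨s', rfl⟩, hv⟩
        rw [← hΦφ hz.1] at hv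
        have := hΦinj (him s') hz.1.le hv
        exact hz.2 (Or.inr (hPJ ⟨s', this⟩))
      · refine ⟨by rw [hcar]; exact ⟨z, ⟨hz.2, fun h ↦ Set.disjoint_left.1 hJA
          (interior_subset hz.1) h⟩, rfl⟩, ?_⟩
        rintro ⟨v, ⟨s', rfl⟩, hv⟩
        rw [← hΦφ hz.2] at hv
        have heq := hΦinj (him s') hz.2.le hv
        have hpos : 0 < (P s').im := by rw [heq]; exact hz.2
        have h1 := hPfr s' hpos
        rw [heq] at h1
        exact (disjoint_interior_frontier (s := J)).le_bot ⟨hz.1, h1⟩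
    · rintro w ⟨hwD₁, hwL⟩
      rw [hcar] at hwD₁
      obtain ⟨z, ⟨hzH, hzA⟩, rfl⟩ := hwD₁
      by_cases hzJ : z ∈ J
      · right
        have hzint : z ∈ interior J := by
          have : z ∈ interior J ∪ frontier J := by
            rw [← closure_eq_interior_union_frontier, hJc.closure_eq]; exact hzJ
          rcases this with h | h
          · exact h
          · exfalso
            have : z ∈ upperHalfPlaneSet ∩ frontier J := ⟨hzH, h⟩
            rw [hfr] at this
            obtain ⟨s', -, hs'⟩ := this
            exact hwL ⟨P s', ⟨s', rfl⟩, by rw [hs', hΦφ hzH]⟩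
        exact ⟨z, ⟨hzint, hzH⟩, rfl⟩
      · left
        exact ⟨z, ⟨hzH, fun h ↦ h.elim hzA hzJ⟩, rfl⟩
  -- the marked points are in the closure of `φ(X)`, off `L`
  have hYT : φ '' Y ⊆ T := by
    rintro _ ⟨z, hz, rfl⟩
    exact ⟨z, interior_subset hz.1, hΦφ hz.2⟩
  have hclX : ∀ {p : ℂ}, p ∈ closure D₁.carrier → p ∉ T → p ∈ closure (φ '' X) := by
    intro p hp hpT
    have hsub : D₁.carrier ⊆ φ '' X ∪ T := by
      intro w hw
      by_cases hwL : w ∈ L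
      · exact Or.inr (hLT hwL)
      · have : w ∈ φ '' X ∪ φ '' Y := by rw [hunion]; exact ⟨hw, hwL⟩
        exact this.elim Or.inl (fun h ↦ Or.inr (hYT h))
    have := closure_mono hsub hp
    rw [closure_union, hTc.closure_eq] at this
    exact this.resolve_right hpT
  have hpt0cl : D.pt 0 ∈ closure (φ '' X) :=
    hclX (by rw [← hD₁.pt_zero_eq]; exact frontier_subset_closure (D₁.pt_mem_frontier 0)) haT
  have hpt1cl : D.pt 1 ∈ closure (φ '' X) :=
    hclX (by rw [← hD₁.pt_one_eq]; exact frontier_subset_closure (D₁.pt_mem_frontier 1)) hbT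
  have hXne : (φ '' X).Nonempty := by
    by_contra h
    rw [not_nonempty_iff_eq_empty] at h
    rw [h, closure_empty] at hpt0cl
    exact hpt0cl
  have hXD : φ '' X ⊆ D.carrier := by rintro _ ⟨z, hz, rfl⟩; exact φ.mapsTo hz.1
  have hpt0X : D.pt 0 ∉ φ '' X := fun h ↦
    Set.disjoint_left.1 D.disjoint_carrier_frontier (hXD h) (D.pt_mem_frontier 0)
  have hpt1X : D.pt 1 ∉ φ '' X := fun h ↦
    Set.disjoint_left.1 D.disjoint_carrier_frontier (hXD h) (D.pt_mem_frontier 1)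
  have hpt : D.pt 0 ≠ D.pt 1 := fun h ↦ by
    have := D.pt_injective h
    exact absurd this (by decide)
  -- cut
  obtain ⟨D₂, hD₂car, hD₂0, hD₂1⟩ := stub_hullApproxDomain_cut D₁.toJordanDomain L s t (φ '' X)
    (φ '' Y) (D.pt 0) (D.pt 1) hst hts hcross hXo hYo hXY hXne hYne hunion hpt hpt0cl hpt0X
    (fun h ↦ haT (hLT h)) hpt1cl hpt1X (fun h ↦ hbT (hLT h))
  -- the removed part stays away from the marked points
  have hdiff : D.carrier \ φ '' X ⊆ (D.carrier \ D₁.carrier) ∪ T := by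
    rintro w ⟨hwD, hwX⟩
    obtain ⟨z, hz, rfl⟩ := φ.bijOn.surjOn hwD
    by_cases hzJ : z ∈ J
    · exact Or.inr ⟨z, hzJ, hΦφ hz⟩
    · by_cases hzA : z ∈ A₁
      · refine Or.inl ⟨hwD, fun hwD₁ ↦ ?_⟩
        rw [hcar] at hwD₁
        obtain ⟨z', hz', hzz'⟩ := hwD₁
        have : z' = z := φ.injOn hz'.1 hz hzz'
        exact hz'.2 (this ▸ hzA)
      · exact absurd ⟨z, ⟨hz, fun h ↦ h.elim hzA hzJ⟩, rfl⟩ hwX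
  have hcl : closure (D.carrier \ φ '' X) ⊆ closure (D.carrier \ D₁.carrier) ∪ T := by
    have := closure_mono hdiff
    rw [closure_union, hTc.closure_eq] at this
    exact this
  refine ⟨D₂, ⟨by rw [hD₂car]; exact hXD, hD₂0, hD₂1, ?_, ?_⟩, hD₂car⟩
  · rw [hD₂car]; exact fun h ↦ (hcl h).elim hD₁.pt_zero_notMem haT
  · rw [hD₂car]; exact fun h ↦ (hcl h).elim hD₁.pt_one_notMem hbT

end Summit.CriticalPhenomena.SAWScalingLimit.Theorems.ObservableToSLE.FloorRatio

end
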